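import Literature.NumberTheory.Transcendental.ZudilinLineIntegral
import Literature.Analysis.Asymptotics.LaplaceMethodMeasurable
import Literature.Analysis.Asymptotics.OscillatingRealPart
import Mathlib.MeasureTheory.Integral.ExpDecay
import HarnessLib

/-!
# Saddle-point asymptotics of Zudilin's linear forms: decay and non-vanishing

Topic `Literature/NumberTheory/Transcendental`; the analytic half of [Zudilin2004, Theorem 3]
(the hypotheses `hdecay`, `hnonvanish` of
`Literature.NumberTheory.Transcendental.Zudilin2004.zudilin_of_linearForms_of_lt`,
`ZudilinOddZeta.lean`). Everything here is PROVED; no definitions, no named facts.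

With `G_n`, `x_n`, `P` of `ZudilinLineIntegral.lean` and the saddle point `κ₀` of
`ZudilinSaddle.lean` we apply the Laplace method with complex phase
(`Literature.Analysis.Asymptotics.tendsto_sqrt_mul_integral_exp_phase_sub_of_measurable`) on the
vertical line `re κ = x₀` ([Zudilin2004, §8 Lemma 20]; [Zudilin2002, §4 Lemmas 3–6]):

* `Zudilin2004.norm_ddphase_sub_le`, `Zudilin2004.taylor_phase_vline` — the second-order Taylor
  estimate `‖Φ(x₀+iu) − Φ(κ₀) + ½Φ''(κ₀)(u−u₀)²‖ ≤ 3|u−u₀|³` on `|u − u₀| ≤ 1/20`;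
* `Zudilin2004.norm_Gfun_mul_cexp_le` — the majorant `‖G_n(u) e^{−nΦ(x₀+iu)}‖ ≤ W₀(u)` for
  `u > 1/10`, `W₀(u) = 8 e^{|C₂| + 2π} (180+2u)^{33} e^{33π}`, once `‖E_n‖ ≤ 2`;
* `Zudilin2004.norm_Gfun_le_of_le_tenth` — below height `1/10`, `‖G_n(u)‖ ≤ C e^{n(Re Φ(κ₀) − 3)}`;
* `Zudilin2004.tendsto_lineIntegral` — `√n e^{−nΦ(κ₀)} ∫_{u>0} G_n(u) du → Λ ≠ 0`;
* `Zudilin2004.S_eventually_eq` — `Sₙ = −π² n^{−13/2} e^{n Re Φ(κ₀)} Im(e^{in Im Φ(κ₀)} Aₙ)` with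
  `Aₙ → Λ`;
* **`Zudilin2004.S_decay`** — `|Sₙ| ≤ e^{−c₁ n}` eventually, for every `c₁ < 227.58`
  (`C₀ = 227.58019…` in the source), and **`Zudilin2004.S_frequently_ne_zero`** — `Sₙ ≠ 0`
  infinitely often (`Im Φ(κ₀) ∉ πℤ`);
* `Zudilin2004.zudilin_of_arith` — the two fed into the glue `zudilin_of_linearForms_of_lt`:
  given the arithmetic of the forms (Lemma 19) and `Φₙ ≥ e^{c₂n}` eventually for some
  `c₂ > 175.42`, one of `ζ(5), ζ(7), ζ(9), ζ(11)` is irrational.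

Auxiliary: `eventually_norm_E_sub_one_lt`, `eventually_norm_E_le_two` (the amplitude
asymptotics above height `1/10`), `tendsto_linePoint`, `tendsto_natCast_mul_phase_sub`
(`n(Φ(x_n+iu) − Φ(x₀+iu)) → 0`), `tendsto_amplitude` (the joint limit `−4e^{A(κ₀)}` of the
normalised integrand), `integrableOn_majorant`, `abs_kfac_le`, `norm_phase_xLine_sub_le`.

## References

* [Zudilin2004] W. Zudilin, *Arithmetic of linear forms involving odd zeta values*, J. Théor.
  Nombres Bordeaux 16 (2004), 251–291, §8, Lemma 20, Proposition 5, Theorem 3.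
* [Zudilin2002] W. Zudilin, Izv. Math. 66 (2002), 489–542, §4, Lemmas 3–6.
-/

noncomputable section

open Complex Finset Filter MeasureTheory Set Literature.Analysis.Asymptotics
open scoped Real Topology

namespace Literature.NumberTheory.Transcendental

namespace Zudilin2004

/-! ### Second-order Taylor estimate of the phase at the saddle -/

/-- `‖Φ''(κ) − Φ''(κ')‖ ≤ 32 ‖κ − κ'‖/(b b')` for `im κ ≥ b > 0`, `im κ' ≥ b' > 0`. [folklore] -/
theorem norm_ddphase_sub_le {κ κ' : ℂ} {b b' : ℝ} (hb : 0 < b) (hb' : 0 < b') (hκ : b ≤ κ.im)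
    (hκ' : b' ≤ κ'.im) : ‖ddphase κ - ddphase κ'‖ ≤ 32 * ‖κ - κ'‖ / (b * b') := by
  -- each term `c/(κ+a) − c/(κ'+a)` is bounded by `|c| ‖κ−κ'‖/(b b')`
  have hterm : ∀ a : ℝ, ‖1 / (κ + a) - 1 / (κ' + a)‖ ≤ ‖κ - κ'‖ / (b * b') := by
    intro a
    have h1 : b ≤ ‖κ + a‖ := hκ.trans ((le_abs_self _).trans (by simpa using abs_im_le_norm (κ + a)))
    have h2 : b' ≤ ‖κ' + a‖ := hκ'.trans ((le_abs_self _).trans (by simpa using abs_im_le_norm (κ' + a)))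
    have hne : κ + a ≠ 0 := norm_pos_iff.1 (hb.trans_le h1)
    have hne' : κ' + a ≠ 0 := norm_pos_iff.1 (hb'.trans_le h2)
    have e : 1 / (κ + a) - 1 / (κ' + a) = (κ' - κ) / ((κ + a) * (κ' + a)) := by
      field_simp; ring
    rw [e, norm_div, norm_mul, norm_sub_rev]
    exact div_le_div₀ (norm_nonneg _) le_rfl (by positivity) (mul_le_mul h1 h2 hb'.le (norm_nonneg _))
  have h0 : ‖1 / κ - 1 / κ'‖ ≤ ‖κ - κ'‖ / (b * b') := by simpa using hterm 0
  have h27 : ‖1 / (κ - 27) - 1 / (κ' - 27)‖ ≤ ‖κ - κ'‖ / (b * b') := by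
    have := hterm (-27); push_cast at this; simpa [sub_eq_add_neg] using this
  have h64 : ‖1 / (κ + 64) - 1 / (κ' + 64)‖ ≤ ‖κ - κ'‖ / (b * b') := by simpa using hterm 64
  have h37 : ‖1 / (κ + 37) - 1 / (κ' + 37)‖ ≤ ‖κ - κ'‖ / (b * b') := by simpa using hterm 37
  have hsum : ‖∑ u ∈ Icc (1 : ℕ) 10, ((1 / (κ + 25 + (u : ℂ)) - 1 / (κ + 12 - (u : ℂ))) -
      (1 / (κ' + 25 + (u : ℂ)) - 1 / (κ' + 12 - (u : ℂ))))‖ ≤ 10 * (2 * (‖κ - κ'‖ / (b * b'))) := by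
    refine (norm_sum_le _ _).trans ?_
    have : ∀ u ∈ Finset.Icc (1 : ℕ) 10, ‖(1 / (κ + 25 + (u : ℂ)) - 1 / (κ + 12 - (u : ℂ))) -
        (1 / (κ' + 25 + (u : ℂ)) - 1 / (κ' + 12 - (u : ℂ)))‖ ≤ 2 * (‖κ - κ'‖ / (b * b')) := by
      intro u _
      have i1 := hterm (25 + u)
      have i2 := hterm (12 - u)
      push_cast at i1 i2
      rw [show (1 / (κ + 25 + (u : ℂ)) - 1 / (κ + 12 - (u : ℂ))) - (1 / (κ' + 25 + (u : ℂ)) - 1 / (κ' + 12 - (u : ℂ)))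
        = (1 / (κ + (25 + u)) - 1 / (κ' + (25 + u))) - (1 / (κ + (12 - u)) - 1 / (κ' + (12 - u))) by ring]
      exact (norm_sub_le _ _).trans (by linarith)
    exact (sum_le_sum this).trans (by simp)
  have e3 : ∀ z : ℂ, ‖(3 : ℂ) * z‖ = 3 * ‖z‖ := fun z ↦ by rw [norm_mul, Complex.norm_ofNat]
  have e : ddphase κ - ddphase κ' = 3 * (1 / κ - 1 / κ') - 3 * (1 / (κ - 27) - 1 / (κ' - 27)) +
      3 * (1 / (κ + 64) - 1 / (κ' + 64)) - 3 * (1 / (κ + 37) - 1 / (κ' + 37)) - ∑ u ∈ Finset.Icc (1 : ℕ) 10,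
        ((1 / (κ + 25 + (u : ℂ)) - 1 / (κ + 12 - (u : ℂ))) - (1 / (κ' + 25 + (u : ℂ)) - 1 / (κ' + 12 - (u : ℂ)))) := by
    unfold ddphase
    simp only [Finset.sum_sub_distrib]
    ring
  rw [e]
  calc _ ≤ 3 * (‖κ - κ'‖ / (b * b')) + 3 * (‖κ - κ'‖ / (b * b')) + 3 * (‖κ - κ'‖ / (b * b')) +
        3 * (‖κ - κ'‖ / (b * b')) + 10 * (2 * (‖κ - κ'‖ / (b * b'))) := by
          refine (norm_sub_le _ _).trans (add_le_add ?_ hsum)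
          refine (norm_sub_le _ _).trans (add_le_add ?_ (by rw [e3]; linarith))
          refine (norm_add_le _ _).trans (add_le_add ?_ (by rw [e3]; linarith))
          refine (norm_sub_le _ _).trans (add_le_add (by rw [e3]; linarith) (by rw [e3]; linarith))
    _ = 32 * ‖κ - κ'‖ / (b * b') := by ring

/-- **Second-order Taylor estimate on the line**: for `|u − u₀| ≤ 1/20`,
`‖Φ(x₀ + iu) − Φ(κ₀) + ½Φ''(κ₀) (u − u₀)²‖ ≤ 3 |u − u₀|³`
(`Φ'(κ₀) = 0`; `‖Φ''(x₀+iu) − Φ''(κ₀)‖ ≤ 3|u − u₀|` there). [cite: Zudilin2004, §8 Lemma 20] -/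
theorem taylor_phase_vline {u : ℝ} (hu : |u - u0| ≤ 1 / 20) :
    ‖phase ((x0 : ℂ) + u * I) - phase saddle + ddphase saddle / 2 * (u - u0) ^ 2‖ ≤ 3 * |u - u0| ^ 3 := by
  have hu0 := u0_bounds
  -- the window
  have hwin : ∀ s : ℝ, |s - u0| ≤ |u - u0| → u0 - 1 / 20 ≤ s ∧ s ≤ u0 + 1 / 20 := fun s hs ↦ by
    have := hs.trans hu; rw [abs_le] at this; constructor <;> linarith
  set g : ℝ → ℂ := fun s ↦ phase ((x0 : ℂ) + s * I) - phase saddle + ddphase saddle / 2 * (s - u0) ^ 2 with hg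
  set g' : ℝ → ℂ := fun s ↦ dphase ((x0 : ℂ) + s * I) * I + ddphase saddle / 2 * (2 * (s - u0)) with hg'
  set g'' : ℝ → ℂ := fun s ↦ ddphase ((x0 : ℂ) + s * I) * I * I + ddphase saddle / 2 * 2 with hg''
  have hgd : ∀ s : ℝ, 0 < s → HasDerivAt g (g' s) s := by
    intro s hs
    have h1 := hasDerivAt_phase_vline (x := x0) hs
    have h2 : HasDerivAt (fun s : ℝ ↦ ddphase saddle / 2 * ((s : ℂ) - u0) ^ 2)
        (ddphase saddle / 2 * (2 * ((s : ℂ) - u0))) s := by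
      have := ((hasDerivAt_id (s : ℂ)).sub_const (u0 : ℂ)).pow 2 |>.const_mul (ddphase saddle / 2)
      simpa using this.comp_ofReal
    have := (h1.sub_const (phase saddle)).add h2
    refine this.congr_deriv ?_
    simp [hg']
  have hg'd : ∀ s : ℝ, 0 < s → HasDerivAt g' (g'' s) s := by
    intro s hs
    have h1 := (hasDerivAt_dphase_vline (x := x0) hs).mul_const I
    have h2 : HasDerivAt (fun s : ℝ ↦ ddphase saddle / 2 * (2 * ((s : ℂ) - u0)))
        (ddphase saddle / 2 * 2) s := by
      have := (((hasDerivAt_id (s : ℂ)).sub_const (u0 : ℂ)).const_mul 2).const_mul (ddphase saddle / 2)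
      simpa using this.comp_ofReal
    exact (h1.add h2).congr_deriv (by simp [hg''])
  -- values at `u₀`
  have hg0 : g u0 = 0 := by simp [hg, x0_add_u0_I]
  have hg'0 : g' u0 = 0 := by simp [hg', x0_add_u0_I, saddle_spec'.2]
  -- `‖g''(s)‖ ≤ 3 |s − u₀|` on the window
  have hg''le : ∀ s : ℝ, |s - u0| ≤ |u - u0| → ‖g'' s‖ ≤ 3 * |s - u0| := by
    intro s hs
    obtain ⟨hs1, hs2⟩ := hwin s hs
    have e : g'' s = -(ddphase ((x0 : ℂ) + s * I) - ddphase saddle) := by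
      simp only [hg'', mul_assoc, Complex.I_mul_I]; ring
    rw [e, norm_neg]
    have h := norm_ddphase_sub_le (κ := (x0 : ℂ) + s * I) (κ' := saddle) (b := 327 / 100) (b' := 332 / 100)
      (by norm_num) (by norm_num) (by simp; linarith) (by rw [← x0_add_u0_I]; simp; linarith)
    have hdist : ‖(x0 : ℂ) + s * I - saddle‖ = |s - u0| := by
      rw [← x0_add_u0_I, show (x0 : ℂ) + s * I - ((x0 : ℂ) + u0 * I) = ((s - u0 : ℝ) : ℂ) * I by push_cast; ring,
        norm_mul, Complex.norm_I, mul_one, Complex.norm_real, Real.norm_eq_abs]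
    rw [hdist] at h
    refine h.trans ?_
    rw [div_le_iff₀ (by norm_num)]
    nlinarith [abs_nonneg (s - u0)]
  -- first integration: `‖g'(s)‖ ≤ 3 |s − u₀|²`
  have hpos : ∀ s : ℝ, |s - u0| ≤ |u - u0| → 0 < s := fun s hs ↦ by linarith [(hwin s hs).1]
  have hg'le : ∀ s : ℝ, |s - u0| ≤ |u - u0| → ‖g' s‖ ≤ 3 * |s - u0| ^ 2 := by
    intro s hs
    have hseg : ∀ r ∈ Set.uIcc u0 s, |r - u0| ≤ |s - u0| := by
      intro r hr
      rcases le_or_gt u0 s with hle | hle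
      · rw [Set.uIcc_of_le hle] at hr
        rw [abs_of_nonneg (by linarith [hr.1]), abs_of_nonneg (by linarith)]; linarith [hr.2]
      · rw [Set.uIcc_of_ge hle.le] at hr
        rw [abs_of_nonpos (by linarith [hr.2]), abs_of_neg (by linarith)]; linarith [hr.1]
    have key := Convex.norm_image_sub_le_of_norm_hasDerivWithin_le (f := g') (f' := g'')
      (s := Set.uIcc u0 s) (C := 3 * |s - u0|)
      (fun r hr ↦ (hg'd r (hpos r ((hseg r hr).trans hs))).hasDerivWithinAt)
      (fun r hr ↦ (hg''le r ((hseg r hr).trans hs)).trans (by nlinarith [hseg r hr]))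
      (convex_uIcc u0 s) Set.left_mem_uIcc Set.right_mem_uIcc
    rw [hg'0, sub_zero, Real.norm_eq_abs] at key
    nlinarith [key, abs_nonneg (s - u0)]
  -- second integration
  have hseg : ∀ r ∈ Set.uIcc u0 u, |r - u0| ≤ |u - u0| := by
    intro r hr
    rcases le_or_gt u0 u with hle | hle
    · rw [Set.uIcc_of_le hle] at hr
      rw [abs_of_nonneg (by linarith [hr.1]), abs_of_nonneg (by linarith)]; linarith [hr.2]
    · rw [Set.uIcc_of_ge hle.le] at hr
      rw [abs_of_nonpos (by linarith [hr.2]), abs_of_neg (by linarith)]; linarith [hr.1]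
  have key := Convex.norm_image_sub_le_of_norm_hasDerivWithin_le (f := g) (f' := g')
    (s := Set.uIcc u0 u) (C := 3 * |u - u0| ^ 2)
    (fun r hr ↦ (hgd r (hpos r (hseg r hr))).hasDerivWithinAt)
    (fun r hr ↦ (hg'le r (hseg r hr)).trans (by nlinarith [hseg r hr, abs_nonneg (r - u0), abs_nonneg (u - u0)]))
    (convex_uIcc u0 u) Set.left_mem_uIcc Set.right_mem_uIcc
  rw [hg0, sub_zero, Real.norm_eq_abs] at key
  calc ‖phase ((x0 : ℂ) + u * I) - phase saddle + ddphase saddle / 2 * (u - u0) ^ 2‖ = ‖g u‖ := by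
        simp [hg]
    _ ≤ 3 * |u - u0| ^ 2 * |u - u0| := key
    _ = 3 * |u - u0| ^ 3 := by ring

/-! ### The majorant above height `1/10` -/

/-- `|e^{2y} sinh y/cosh³ y| ≤ 4` for `y ≥ 0`. [folklore] -/
theorem abs_kfac_le {y : ℝ} (hy : 0 ≤ y) : |Real.sinh y / Real.cosh y ^ 3 * Real.exp (2 * y)| ≤ 4 := by
  rw [abs_of_nonneg (mul_nonneg (sinh_div_cosh_cube_nonneg hy) (Real.exp_pos _).le)]
  have h := sinh_div_cosh_cube_le hy
  have he : Real.exp (-2 * y) * Real.exp (2 * y) = 1 := by rw [← Real.exp_add]; simp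
  calc Real.sinh y / Real.cosh y ^ 3 * Real.exp (2 * y) ≤ 4 * Real.exp (-2 * y) * Real.exp (2 * y) :=
        mul_le_mul_of_nonneg_right h (Real.exp_pos _).le
    _ = 4 := by rw [mul_assoc, he, mul_one]

/-- The horizontal shift costs `O(1/n)`: `‖Φ(x_n + iu) − Φ(x₀ + iu)‖ ≤ (32(log(180+2u)+π)+2π)/(2n)`
(`u > 0`, `n ≥ 1`). [cite: Zudilin2004, §8 Lemma 20] -/
theorem norm_phase_xLine_sub_le {n : ℕ} (hn : 1 ≤ n) {u : ℝ} (hu : 0 < u) :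
    ‖phase ((xLine n : ℂ) + u * I) - phase ((x0 : ℂ) + u * I)‖ ≤
      (32 * (Real.log (180 + 2 * u) + π) + 2 * π) * (1 / (2 * n)) := by
  have hx := xLine_mem hn
  have hx0 := x0_bounds
  refine (norm_phase_sub_phase_le hu (by linarith) (by linarith) hx.1 hx.2).trans ?_
  refine mul_le_mul_of_nonneg_left (abs_xLine_sub_x0_le hn) ?_
  have : 0 ≤ Real.log (180 + 2 * u) := Real.log_nonneg (by linarith)
  positivity

/-- **The majorant.** If `‖E_n(κ)‖ ≤ 2` for `im κ ≥ 1/10` (`E_n = Rₙ(nκ)n⁷e^{−(nψ+A)}`), then for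
`u > 1/10` and `n ≥ 1`,
`‖G_n(u) e^{−nΦ(x₀+iu)}‖ ≤ 8 exp(17(log(180+2u)+π) + |C₂| + (32(log(180+2u)+π)+2π)/2)`.
[cite: Zudilin2004, §8 Lemma 20] -/
theorem norm_Gfun_mul_cexp_le {n : ℕ} (hn : 1 ≤ n)
    (hE : ∀ κ : ℂ, 1 / 10 ≤ κ.im → ‖R n ((n : ℂ) * κ) * (n : ℂ) ^ 7 * cexp (-((n : ℂ) * psiR κ + amp κ))‖ ≤ 2)
    {u : ℝ} (hu : 1 / 10 < u) :
    ‖Gfun n u * cexp (-((n : ℂ) * phase ((x0 : ℂ) + u * I)))‖ ≤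
      8 * Real.exp (17 * (Real.log (180 + 2 * u) + π) +
        |1 / 2 * ∑ v ∈ Icc (1 : ℕ) 10, Real.log (2 * Real.pi * (13 + 2 * (v : ℝ))) - 3 * Real.log (54 * Real.pi)| +
        (32 * (Real.log (180 + 2 * u) + π) + 2 * π) / 2) := by
  have hu0 : 0 < u := by linarith
  have hn' : (0 : ℝ) < n := by exact_mod_cast hn
  set κ : ℂ := (xLine n : ℂ) + u * I with hκ
  have hκim : κ.im = u := by simp [hκ]
  have hκre : κ.re = xLine n := by simp [hκ]
  have hx := xLine_mem hn
  set B := Real.log (180 + 2 * u) + π with hB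
  set C₂ : ℝ := 1 / 2 * ∑ v ∈ Icc (1 : ℕ) 10, Real.log (2 * Real.pi * (13 + 2 * (v : ℝ))) -
    3 * Real.log (54 * Real.pi) with hC₂
  rw [Gfun_eq hn u]
  -- the four factors
  have f1 : ‖R n ((n : ℂ) * κ) * (n : ℂ) ^ 7 * cexp (-((n : ℂ) * psiR κ + amp κ))‖ ≤ 2 :=
    hE κ (by rw [hκim]; exact hu.le)
  have f2 : ‖cexp (amp κ)‖ ≤ Real.exp (17 * B + |C₂|) := by
    rw [Complex.norm_exp]
    refine Real.exp_le_exp.2 ((re_le_norm _).trans ?_)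
    have := norm_amp_le (κ := κ) (by rw [hκre]; linarith) (by rw [hκre]; linarith) (by rw [hκim]; exact hu0)
    rw [hκim] at this
    exact this
  have f3 : ‖((Real.sinh (π * (n * u)) / Real.cosh (π * (n * u)) ^ 3 * Real.exp (2 * (π * (n * u))) : ℝ) : ℂ)‖ ≤ 4 := by
    rw [Complex.norm_real, Real.norm_eq_abs]
    exact abs_kfac_le (by positivity)
  have f4 : ‖cexp ((n : ℂ) * phase κ) * cexp (-((n : ℂ) * phase ((x0 : ℂ) + u * I)))‖ ≤
      Real.exp ((32 * B + 2 * π) / 2) := by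
    rw [← Complex.exp_add, Complex.norm_exp]
    refine Real.exp_le_exp.2 ?_
    have e : (n : ℂ) * phase κ + -((n : ℂ) * phase ((x0 : ℂ) + u * I)) =
        (n : ℂ) * (phase κ - phase ((x0 : ℂ) + u * I)) := by ring
    rw [e]
    refine (re_le_norm _).trans ?_
    rw [norm_mul, Complex.norm_natCast]
    have h := norm_phase_xLine_sub_le hn hu0
    rw [← hB] at h
    calc (n : ℝ) * ‖phase κ - phase ((x0 : ℂ) + u * I)‖ ≤ n * ((32 * B + 2 * π) * (1 / (2 * n))) :=
          mul_le_mul_of_nonneg_left h hn'.le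
      _ = (32 * B + 2 * π) / 2 := by field_simp
  calc ‖-(R n ((n : ℂ) * κ) * (n : ℂ) ^ 7 * cexp (-((n : ℂ) * psiR κ + amp κ))) * cexp (amp κ) *
        ((Real.sinh (π * (n * u)) / Real.cosh (π * (n * u)) ^ 3 * Real.exp (2 * (π * (n * u))) : ℝ) : ℂ) *
        cexp ((n : ℂ) * phase κ) * cexp (-((n : ℂ) * phase ((x0 : ℂ) + u * I)))‖
      = ‖R n ((n : ℂ) * κ) * (n : ℂ) ^ 7 * cexp (-((n : ℂ) * psiR κ + amp κ))‖ * ‖cexp (amp κ)‖ *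
        ‖((Real.sinh (π * (n * u)) / Real.cosh (π * (n * u)) ^ 3 * Real.exp (2 * (π * (n * u))) : ℝ) : ℂ)‖ *
        ‖cexp ((n : ℂ) * phase κ) * cexp (-((n : ℂ) * phase ((x0 : ℂ) + u * I)))‖ := by
          rw [mul_assoc _ (cexp ((n : ℂ) * phase κ)), norm_mul, norm_mul, norm_mul, norm_neg]
    _ ≤ 2 * Real.exp (17 * B + |C₂|) * 4 * Real.exp ((32 * B + 2 * π) / 2) := by
          gcongr
    _ = _ := by rw [hC₂]; rw [show (2 : ℝ) * Real.exp (17 * B + |C₂|) * 4 = 8 * Real.exp (17 * B + |C₂|) by ring,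
          mul_assoc, ← Real.exp_add]

/-- The majorant `W₀(u) e^{Re Φ(x₀+iu) − Re Φ(κ₀)}` is integrable on `u > 1/10`: it is continuous and
`O(e^{−u})` (`Re Φ(x₀+iu) ≤ C₁ + 162 log(180+2u) − 2πu`). [cite: Zudilin2004, §8 Lemma 20] -/
theorem integrableOn_majorant (K D : ℝ) :
    IntegrableOn (fun u : ℝ ↦ 8 * Real.exp (17 * (Real.log (180 + 2 * u) + π) + K +
        (32 * (Real.log (180 + 2 * u) + π) + 2 * π) / 2) *
        Real.exp ((phase ((x0 : ℂ) + u * I)).re - D)) (Set.Ioi (1 / 10)) := by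
  have hx0 := x0_bounds
  -- continuity on `[1/10, ∞)`
  have hcontφ : ContinuousOn (fun u : ℝ ↦ (phase ((x0 : ℂ) + u * I)).re) (Set.Ici (1 / 10)) := by
    intro u hu
    have hu0 : (0 : ℝ) < u := lt_of_lt_of_le (by norm_num) hu
    exact (Complex.continuous_re.continuousAt.comp
      (hasDerivAt_phase_vline (x := x0) hu0).continuousAt).continuousWithinAt
  have hcontL : ContinuousOn (fun u : ℝ ↦ Real.log (180 + 2 * u)) (Set.Ici (1 / 10)) :=
    ContinuousOn.log (by fun_prop) fun u hu ↦ by simp only [Set.mem_Ici] at hu; linarith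
  have hcont : ContinuousOn (fun u : ℝ ↦ 8 * Real.exp (17 * (Real.log (180 + 2 * u) + π) + K +
      (32 * (Real.log (180 + 2 * u) + π) + 2 * π) / 2) *
      Real.exp ((phase ((x0 : ℂ) + u * I)).re - D)) (Set.Ici (1 / 10)) := by
    refine (continuousOn_const.mul (Real.continuous_exp.comp_continuousOn ?_)).mul
      (Real.continuous_exp.comp_continuousOn (hcontφ.sub continuousOn_const))
    exact (((continuousOn_const.mul (hcontL.add continuousOn_const)).add continuousOn_const).add
      (((continuousOn_const.mul (hcontL.add continuousOn_const)).add continuousOn_const).div_const _))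
  refine integrable_of_isBigO_exp_neg (b := 1) one_pos hcont ?_
  -- the bound `≤ C' e^{−u}` for large `u`
  set C₁ : ℝ := (∑ u ∈ Icc (1 : ℕ) 10, ((13 + 2 * (u : ℝ)) * Real.log (13 + 2 * (u : ℝ)) -
    (13 + 2 * (u : ℝ))) - 6 * (27 * Real.log 27 - 27)) with hC₁
  have hφ : ∀ u : ℝ, 0 < u → (phase ((x0 : ℂ) + u * I)).re ≤ C₁ + 162 * Real.log (180 + 2 * u) - 2 * π * u := by
    intro u hu
    have h := re_psiR_le (κ := (x0 : ℂ) + u * I) (by simp; linarith) (by simp; linarith) (by simp; exact hu.ne')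
    have e : (phase ((x0 : ℂ) + u * I)).re = (psiR ((x0 : ℂ) + u * I)).re - 2 * π * u := by
      unfold phase; simp; ring
    rw [e]
    simp only [add_im, ofReal_im, mul_im, ofReal_re, I_im, mul_one, I_re, mul_zero, add_zero,
      zero_add, abs_of_pos hu] at h
    linarith
  -- `u^195 e^{-u} → 0`
  have hsmall : ∀ᶠ u : ℝ in atTop, u ^ 195 * Real.exp (-u) ≤ 1 :=
    (Real.tendsto_pow_mul_exp_neg_atTop_nhds_zero 195).eventually (Iic_mem_nhds one_pos)
  rw [Asymptotics.isBigO_iff]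
  refine ⟨8 * Real.exp (17 * π + K + (32 * π + 2 * π) / 2) * Real.exp (C₁ - D) * 3 ^ 195, ?_⟩
  filter_upwards [hsmall, eventually_ge_atTop (180 : ℝ)] with u hs hu
  have hu0 : 0 < u := by linarith
  have hL0 : 0 < 180 + 2 * u := by linarith
  have hlog : Real.log (180 + 2 * u) ≤ Real.log (3 * u) := Real.log_le_log hL0 (by linarith)
  rw [Real.norm_eq_abs, Real.norm_eq_abs, abs_of_pos (Real.exp_pos _),
    abs_of_pos (by positivity)]
  -- monotonicity in the two exponents
  have hX : 17 * (Real.log (180 + 2 * u) + π) + K + (32 * (Real.log (180 + 2 * u) + π) + 2 * π) / 2 ≤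
      17 * (Real.log (3 * u) + π) + K + (32 * (Real.log (3 * u) + π) + 2 * π) / 2 := by linarith
  have hY : (phase ((x0 : ℂ) + u * I)).re - D ≤ C₁ + 162 * Real.log (3 * u) - 2 * π * u - D := by
    linarith [hφ u hu0]
  have e195 : Real.exp (195 * Real.log (3 * u)) = (3 * u) ^ 195 := by
    rw [show (195 : ℝ) * Real.log (3 * u) = Real.log ((3 * u) ^ 195) by rw [Real.log_pow]; norm_num,
      Real.exp_log (by positivity)]
  have ecomb : 8 * Real.exp (17 * (Real.log (3 * u) + π) + K + (32 * (Real.log (3 * u) + π) + 2 * π) / 2) *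
      Real.exp (C₁ + 162 * Real.log (3 * u) - 2 * π * u - D) =
      8 * Real.exp (17 * π + K + (32 * π + 2 * π) / 2) * Real.exp (C₁ - D) *
        ((3 * u) ^ 195 * Real.exp (-(2 * π * u))) := by
    rw [← e195]
    simp only [mul_assoc, ← Real.exp_add]
    ring_nf
  have e3 : (3 * u) ^ 195 * Real.exp (-(2 * π * u)) ≤ 3 ^ 195 * Real.exp (-1 * u) := by
    rw [mul_pow]
    have hpi : Real.exp (-(2 * π * u)) ≤ Real.exp (-u) * Real.exp (-u) := by
      rw [← Real.exp_add]; exact Real.exp_le_exp.2 (by nlinarith [Real.pi_gt_three])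
    calc (3 : ℝ) ^ 195 * u ^ 195 * Real.exp (-(2 * π * u)) ≤ 3 ^ 195 * u ^ 195 * (Real.exp (-u) * Real.exp (-u)) :=
          mul_le_mul_of_nonneg_left hpi (by positivity)
      _ = 3 ^ 195 * (u ^ 195 * Real.exp (-u)) * Real.exp (-u) := by ring
      _ ≤ 3 ^ 195 * 1 * Real.exp (-u) := by gcongr
      _ = 3 ^ 195 * Real.exp (-1 * u) := by ring_nf
  calc _ ≤ 8 * Real.exp (17 * (Real.log (3 * u) + π) + K + (32 * (Real.log (3 * u) + π) + 2 * π) / 2) *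
        Real.exp (C₁ + 162 * Real.log (3 * u) - 2 * π * u - D) := by gcongr
    _ = 8 * Real.exp (17 * π + K + (32 * π + 2 * π) / 2) * Real.exp (C₁ - D) *
        ((3 * u) ^ 195 * Real.exp (-(2 * π * u))) := ecomb
    _ ≤ 8 * Real.exp (17 * π + K + (32 * π + 2 * π) / 2) * Real.exp (C₁ - D) * (3 ^ 195 * Real.exp (-1 * u)) :=
        mul_le_mul_of_nonneg_left e3 (by positivity)
    _ = _ := by ring

/-! ### Below height `1/10` -/

/-- **The crude bound near the real axis.** If `‖E_n(κ)‖ ≤ 2` for `im κ ≥ 1/10`, then for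
`0 < u ≤ 1/10` and `n ≥ 1`, `‖G_n(u)‖ ≤ C_G e^{n(Re Φ(κ₀) − 3)}` with
`C_G = 8 exp(17(log 180.2 + π) + |C₂| + (32(log 180.2+π)+2π)/2)`: push the point down the line
`re k = m_n + ½` from height `n/10` (`norm_R_vline_le`), where the amplitude asymptotics and the
value `Re Φ(x₀ + i/10) ≤ Re Φ(κ₀) − 4` apply. [cite: Zudilin2004, §8 Lemma 20] -/
theorem norm_Gfun_le_of_le_tenth {n : ℕ} (hn : 1 ≤ n)
    (hE : ∀ κ : ℂ, 1 / 10 ≤ κ.im → ‖R n ((n : ℂ) * κ) * (n : ℂ) ^ 7 * cexp (-((n : ℂ) * psiR κ + amp κ))‖ ≤ 2)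
    {u : ℝ} (hu0 : 0 < u) (hu : u ≤ 1 / 10) :
    ‖Gfun n u‖ ≤ 8 * Real.exp (17 * (Real.log (180 + 2 * (1 / 10)) + π) +
        |1 / 2 * ∑ v ∈ Icc (1 : ℕ) 10, Real.log (2 * Real.pi * (13 + 2 * (v : ℝ))) - 3 * Real.log (54 * Real.pi)| +
        (32 * (Real.log (180 + 2 * (1 / 10)) + π) + 2 * π) / 2) *
      Real.exp (n * ((phase saddle).re - 3)) := by
  have hn' : (0 : ℝ) < n := by exact_mod_cast hn
  have hn1 : (1 : ℝ) ≤ n := by exact_mod_cast hn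
  have hx := xLine_mem hn
  set u₁ : ℝ := 1 / 10 with hu₁
  set κ₁ : ℂ := (xLine n : ℂ) + u₁ * I with hκ₁
  set B := Real.log (180 + 2 * u₁) + π with hB
  set C₂ : ℝ := 1 / 2 * ∑ v ∈ Icc (1 : ℕ) 10, Real.log (2 * Real.pi * (13 + 2 * (v : ℝ))) -
    3 * Real.log (54 * Real.pi) with hC₂
  -- Step 1: `‖G‖ ≤ n⁷ ‖R(n κ_u)‖ · 4`
  have hK : ‖kerK (n * u)‖ ≤ 4 := norm_kerK_le_four (by positivity)
  -- Step 2: push down: `‖R(n κ_u)‖ ≤ ‖R(n κ₁)‖ e^{n/387}`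
  set c : ℝ := (mLine n : ℝ) + 1 / 2 with hc
  have hc0 : 0 < c := by positivity
  have hcx : c = n * xLine n := (natCast_mul_xLine hn).symm
  have hc22 : 22 * n ≤ c := by rw [hcx]; nlinarith [hx.1]
  have hpt : ∀ v : ℝ, (n : ℂ) * ((xLine n : ℂ) + v * I) = (c : ℂ) + ((n : ℝ) * v : ℝ) * I := fun v ↦ by
    rw [natCast_mul_line hn]
  have hpush : ‖R n ((n : ℂ) * ((xLine n : ℂ) + u * I))‖ ≤ ‖R n ((n : ℂ) * κ₁)‖ * Real.exp (n * (250 / 96800)) := by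
    rw [hpt u, hκ₁, hpt u₁]
    refine (norm_R_vline_le n hc0 (y₁ := n * u₁) ?_).trans ?_
    · rw [abs_of_pos (by positivity)]; exact mul_le_mul_of_nonneg_left hu hn'.le
    refine mul_le_mul_of_nonneg_left (Real.exp_le_exp.2 ?_) (norm_nonneg _)
    rw [div_le_iff₀ (by positivity), hu₁]
    have h1 : (240 * n + 10 : ℝ) ≤ 250 * n := by linarith
    have h2 : (0 : ℝ) ≤ (n * (1 / 10)) ^ 2 := by positivity
    calc (240 * n + 10 : ℝ) * (n * (1 / 10)) ^ 2 ≤ 250 * n * (n * (1 / 10)) ^ 2 :=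
          mul_le_mul_of_nonneg_right h1 h2
      _ = n * (250 / 96800) * (2 * (22 * n) ^ 2) := by ring
      _ ≤ n * (250 / 96800) * (2 * c ^ 2) := by gcongr
  -- Step 3: `n⁷ ‖R(nκ₁)‖ ≤ 2 e^{‖A κ₁‖} e^{n Re ψ(κ₁)}`
  have hE1 := hE κ₁ (by simp [hκ₁])
  have hamp : ‖amp κ₁‖ ≤ 17 * B + |C₂| := by
    have := norm_amp_le (κ := κ₁) (by simp [hκ₁]; linarith) (by simp [hκ₁]; linarith) (by simp [hκ₁, hu₁])
    simpa [hκ₁, hB, hC₂] using this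
  have h3 : (n : ℝ) ^ 7 * ‖R n ((n : ℂ) * κ₁)‖ ≤ 2 * Real.exp (17 * B + |C₂|) * Real.exp (n * (psiR κ₁).re) := by
    have hprod : R n ((n : ℂ) * κ₁) * (n : ℂ) ^ 7 =
        R n ((n : ℂ) * κ₁) * (n : ℂ) ^ 7 * cexp (-((n : ℂ) * psiR κ₁ + amp κ₁)) * cexp (amp κ₁) *
        cexp ((n : ℂ) * psiR κ₁) := by
      rw [mul_assoc (R n ((n : ℂ) * κ₁) * (n : ℂ) ^ 7), mul_assoc (R n ((n : ℂ) * κ₁) * (n : ℂ) ^ 7),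
        ← Complex.exp_add, ← Complex.exp_add,
        show -((n : ℂ) * psiR κ₁ + amp κ₁) + amp κ₁ + (n : ℂ) * psiR κ₁ = 0 by ring, Complex.exp_zero, mul_one]
    have hn7 : (n : ℝ) ^ 7 * ‖R n ((n : ℂ) * κ₁)‖ = ‖R n ((n : ℂ) * κ₁) * (n : ℂ) ^ 7‖ := by
      rw [norm_mul, norm_pow, Complex.norm_natCast, mul_comm]
    have hre : ((n : ℂ) * psiR κ₁).re = n * (psiR κ₁).re := by simp
    rw [hn7, hprod, norm_mul, norm_mul, Complex.norm_exp, Complex.norm_exp, hre]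
    exact mul_le_mul_of_nonneg_right (mul_le_mul hE1 (Real.exp_le_exp.2 ((re_le_norm _).trans hamp))
      (by positivity) (by norm_num)) (by positivity)
  -- Step 4: `Re ψ(κ₁) = Re Φ(κ₁) + 2π u₁ ≤ Re Φ(κ₀) − 4 + Lip/(2n) + 2π/10`
  have h4 : (psiR κ₁).re ≤ (phase saddle).re - 4 + (32 * B + 2 * π) * (1 / (2 * n)) + 2 * π * u₁ := by
    have e : (psiR κ₁).re = (phase κ₁).re + 2 * π * u₁ := by
      unfold phase; simp [hκ₁]
    rw [e]
    have hshift := norm_phase_xLine_sub_le hn (u := u₁) (by norm_num)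
    rw [← hB] at hshift
    have hten := SaddleNum.re_phase_tenth_add_four_le saddle_mem_boxB (κ' := (x0 : ℂ) + u₁ * I)
      (by simpa using abs_x0_sub_le) (by simp [hu₁])
    have hre := (abs_re_le_norm (phase κ₁ - phase ((x0 : ℂ) + u₁ * I))).trans hshift
    rw [sub_re, abs_le] at hre
    linarith [hre.2]
  -- Step 5: assemble
  have hexp : Real.exp (n * (psiR κ₁).re) * Real.exp (n * (250 / 96800)) ≤
      Real.exp ((32 * B + 2 * π) / 2) * Real.exp (n * ((phase saddle).re - 3)) := by
    rw [← Real.exp_add, ← Real.exp_add]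
    refine Real.exp_le_exp.2 ?_
    have h5 : (n : ℝ) * (psiR κ₁).re ≤ n * ((phase saddle).re - 4 + 2 * π * u₁) + (32 * B + 2 * π) / 2 := by
      have := mul_le_mul_of_nonneg_left h4 hn'.le
      have e : (n : ℝ) * ((32 * B + 2 * π) * (1 / (2 * n))) = (32 * B + 2 * π) / 2 := by field_simp
      nlinarith [e]
    have hpi := Real.pi_lt_d2
    rw [hu₁] at h5
    nlinarith
  unfold Gfun
  rw [norm_mul, norm_mul, norm_pow, Complex.norm_natCast]
  calc (n : ℝ) ^ 7 * ‖R n ((n : ℂ) * ((xLine n : ℂ) + u * I))‖ * ‖kerK (n * u)‖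
      ≤ (n : ℝ) ^ 7 * (‖R n ((n : ℂ) * κ₁)‖ * Real.exp (n * (250 / 96800))) * 4 := by gcongr
    _ = ((n : ℝ) ^ 7 * ‖R n ((n : ℂ) * κ₁)‖) * Real.exp (n * (250 / 96800)) * 4 := by ring
    _ ≤ (2 * Real.exp (17 * B + |C₂|) * Real.exp (n * (psiR κ₁).re)) * Real.exp (n * (250 / 96800)) * 4 := by
        gcongr
    _ = 8 * Real.exp (17 * B + |C₂|) * (Real.exp (n * (psiR κ₁).re) * Real.exp (n * (250 / 96800))) := by ring
    _ ≤ 8 * Real.exp (17 * B + |C₂|) * (Real.exp ((32 * B + 2 * π) / 2) * Real.exp (n * ((phase saddle).re - 3))) :=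
        mul_le_mul_of_nonneg_left hexp (by positivity)
    _ = _ := by rw [hB, hC₂, hu₁, ← mul_assoc, mul_assoc (8 : ℝ), ← Real.exp_add]

/-! ### The normalised amplitude near the saddle -/

/-- Uniform closeness of `E_n(κ) = Rₙ(nκ) n⁷ e^{−(nψ(κ)+A(κ))}` to `1` above height `1/10`.
[cite: Zudilin2004, §8 Lemma 20] -/
theorem eventually_norm_E_sub_one_lt {ε : ℝ} (hε : 0 < ε) :
    ∀ᶠ n : ℕ in atTop, ∀ κ : ℂ, 1 / 10 ≤ κ.im →
      ‖R n ((n : ℂ) * κ) * (n : ℂ) ^ 7 * cexp (-((n : ℂ) * psiR κ + amp κ)) - 1‖ < ε := by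
  have h := (Metric.tendstoUniformlyOn_iff.1 (tendstoUniformlyOn_R_scaled (u₁ := 1 / 10) (by norm_num))) ε hε
  filter_upwards [h] with n hn κ hκ
  have := hn κ hκ
  rwa [dist_comm, dist_eq_norm] at this

/-- `‖E_n(κ)‖ ≤ 2` above height `1/10`, eventually. [cite: Zudilin2004, §8 Lemma 20] -/
theorem eventually_norm_E_le_two :
    ∀ᶠ n : ℕ in atTop, ∀ κ : ℂ, 1 / 10 ≤ κ.im →
      ‖R n ((n : ℂ) * κ) * (n : ℂ) ^ 7 * cexp (-((n : ℂ) * psiR κ + amp κ))‖ ≤ 2 := by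
  filter_upwards [eventually_norm_E_sub_one_lt one_pos] with n hn κ hκ
  have h := hn κ hκ
  have := norm_le_norm_sub_add (R n ((n : ℂ) * κ) * (n : ℂ) ^ 7 * cexp (-((n : ℂ) * psiR κ + amp κ))) 1
  rw [norm_one] at this
  linarith

/-- The point `x_n + iu → κ₀` as `(n, u) → (∞, u₀)`. [folklore] -/
theorem tendsto_linePoint :
    Tendsto (fun p : ℕ × ℝ ↦ (xLine p.1 : ℂ) + p.2 * I) (atTop ×ˢ 𝓝 u0) (𝓝 saddle) := by
  rw [← x0_add_u0_I]
  have h1 : Tendsto (fun p : ℕ × ℝ ↦ (xLine p.1 : ℂ)) (atTop ×ˢ 𝓝 u0) (𝓝 (x0 : ℂ)) :=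
    (Complex.continuous_ofReal.tendsto x0).comp (tendsto_xLine.comp tendsto_fst)
  have h2 : Tendsto (fun p : ℕ × ℝ ↦ (p.2 : ℂ)) (atTop ×ˢ 𝓝 u0) (𝓝 (u0 : ℂ)) :=
    (Complex.continuous_ofReal.tendsto u0).comp tendsto_snd
  exact h1.add (h2.mul_const I)

/-- The horizontal shift is negligible at the saddle:
`n (Φ(x_n + iu) − Φ(x₀ + iu)) → 0` as `(n, u) → (∞, u₀)` (`Φ'(κ₀) = 0`). [cite: Zudilin2004, §8 Lemma 20] -/
theorem tendsto_natCast_mul_phase_sub :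
    Tendsto (fun p : ℕ × ℝ ↦ (p.1 : ℂ) * (phase ((xLine p.1 : ℂ) + p.2 * I) - phase ((x0 : ℂ) + p.2 * I)))
      (atTop ×ˢ 𝓝 u0) (𝓝 0) := by
  have hu0 := u0_bounds
  rw [Metric.tendsto_nhds]
  intro ε hε
  -- continuity of `Φ'` at the saddle, where it vanishes
  have hopen : IsOpen {κ : ℂ | 0 < κ.im} := isOpen_lt continuous_const Complex.continuous_im
  have hsad : saddle ∈ {κ : ℂ | 0 < κ.im} := by
    rw [← x0_add_u0_I]; simp; linarith
  have hcont : ContinuousAt dphase saddle := continuousOn_dphase.continuousAt (hopen.mem_nhds hsad)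
  obtain ⟨ρ, hρ, hρε⟩ := Metric.continuousAt_iff.1 hcont ε hε
  -- eventually `1/(2n) < ρ/2` and `|u − u₀| < ρ/2`
  have hn : ∀ᶠ n : ℕ in atTop, 1 / (2 * (n : ℝ)) < ρ / 2 ∧ 1 ≤ n := by
    have h2 : Tendsto (fun n : ℕ ↦ 2 * (n : ℝ)) atTop atTop :=
      (tendsto_natCast_atTop_atTop (R := ℝ)).const_mul_atTop (by norm_num)
    have h : Tendsto (fun n : ℕ ↦ (1 : ℝ) / (2 * (n : ℝ))) atTop (𝓝 0) := tendsto_const_nhds.div_atTop h2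
    exact (h.eventually (Iio_mem_nhds (by positivity : (0 : ℝ) < ρ / 2))).and (eventually_ge_atTop 1)
  have hu : ∀ᶠ u : ℝ in 𝓝 u0, |u - u0| < min (ρ / 2) 1 :=
    Metric.eventually_nhds_iff.2 ⟨min (ρ / 2) 1, by positivity, fun u hu ↦ by rwa [Real.dist_eq] at hu⟩
  filter_upwards [hn.prod_mk hu] with p ⟨⟨hn1, hn2⟩, hp2⟩
  have hu1 : |p.2 - u0| < ρ / 2 := lt_of_lt_of_le hp2 (min_le_left _ _)
  have hupos : 0 < p.2 := by
    have := lt_of_lt_of_le hp2 (min_le_right _ _); rw [abs_lt] at this; linarith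
  -- the derivative bound on the horizontal segment
  have hbound : ∀ t ∈ Set.uIcc x0 (xLine p.1), ‖dphase ((t : ℂ) + p.2 * I)‖ ≤ ε := by
    intro t ht
    have hdt : |t - x0| ≤ |xLine p.1 - x0| := by
      rcases le_or_gt x0 (xLine p.1) with hle | hle
      · rw [Set.uIcc_of_le hle] at ht
        rw [abs_of_nonneg (by linarith [ht.1]), abs_of_nonneg (by linarith)]; linarith [ht.2]
      · rw [Set.uIcc_of_ge hle.le] at ht
        rw [abs_of_nonpos (by linarith [ht.2]), abs_of_neg (by linarith)]; linarith [ht.1]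
    have hdist : dist ((t : ℂ) + p.2 * I) saddle < ρ := by
      rw [dist_eq_norm, ← x0_add_u0_I,
        show (t : ℂ) + p.2 * I - ((x0 : ℂ) + u0 * I) = ((t - x0 : ℝ) : ℂ) + ((p.2 - u0 : ℝ) : ℂ) * I by push_cast; ring]
      refine (norm_add_le _ _).trans_lt ?_
      rw [norm_mul, Complex.norm_I, mul_one, Complex.norm_real, Complex.norm_real, Real.norm_eq_abs,
        Real.norm_eq_abs]
      have := abs_xLine_sub_x0_le hn2
      linarith
    have := hρε hdist
    rw [saddle_spec'.2, dist_zero_right] at this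
    exact this.le
  have hderiv : ∀ t ∈ Set.uIcc x0 (xLine p.1),
      HasDerivWithinAt (fun t : ℝ ↦ phase ((t : ℂ) + p.2 * I)) (dphase ((t : ℂ) + p.2 * I)) (Set.uIcc x0 (xLine p.1)) t := by
    intro t _
    have h1 : HasDerivAt (fun z : ℂ ↦ phase (z + p.2 * I)) (dphase ((t : ℂ) + p.2 * I)) (t : ℂ) :=
      HasDerivAt.comp_add_const (t : ℂ) (p.2 * I) (hasDerivAt_phase (by simp [hupos]))
    exact h1.comp_ofReal.hasDerivWithinAt
  have hmvt := Convex.norm_image_sub_le_of_norm_hasDerivWithin_le hderiv hbound (convex_uIcc _ _)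
    Set.left_mem_uIcc Set.right_mem_uIcc
  rw [Real.norm_eq_abs] at hmvt
  rw [dist_zero_right, norm_mul, Complex.norm_natCast]
  have hn' : (0 : ℝ) < p.1 := by exact_mod_cast hn2
  calc (p.1 : ℝ) * ‖phase ((xLine p.1 : ℂ) + p.2 * I) - phase ((x0 : ℂ) + p.2 * I)‖
      ≤ p.1 * (ε * |xLine p.1 - x0|) := mul_le_mul_of_nonneg_left hmvt hn'.le
    _ ≤ p.1 * (ε * (1 / (2 * p.1))) := by gcongr; exact abs_xLine_sub_x0_le hn2
    _ = ε / 2 := by field_simp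
    _ < ε := by linarith

/-- **The limit of the normalised integrand at the saddle**: as `(n, u) → (∞, u₀)`,
`−E_n(κ) e^{A(κ)} k(nu) e^{n(Φ(κ) − Φ(x₀+iu))} → −4 e^{A(κ₀)}` (`κ = x_n + iu`).
[cite: Zudilin2004, §8 Lemma 20] -/
theorem tendsto_amplitude :
    Tendsto (fun p : ℕ × ℝ ↦
      -(R p.1 ((p.1 : ℂ) * ((xLine p.1 : ℂ) + p.2 * I)) * (p.1 : ℂ) ^ 7 *
          cexp (-((p.1 : ℂ) * psiR ((xLine p.1 : ℂ) + p.2 * I) + amp ((xLine p.1 : ℂ) + p.2 * I)))) *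
        cexp (amp ((xLine p.1 : ℂ) + p.2 * I)) *
        ((Real.sinh (π * (p.1 * p.2)) / Real.cosh (π * (p.1 * p.2)) ^ 3 * Real.exp (2 * (π * (p.1 * p.2))) : ℝ) : ℂ) *
        (cexp ((p.1 : ℂ) * phase ((xLine p.1 : ℂ) + p.2 * I)) * cexp (-((p.1 : ℂ) * phase ((x0 : ℂ) + p.2 * I)))))
      (atTop ×ˢ 𝓝 u0) (𝓝 (-4 * cexp (amp saddle))) := by
  have hu0 := u0_bounds
  -- (1) `E_n(κ) → 1`
  have hE : Tendsto (fun p : ℕ × ℝ ↦ R p.1 ((p.1 : ℂ) * ((xLine p.1 : ℂ) + p.2 * I)) * (p.1 : ℂ) ^ 7 *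
      cexp (-((p.1 : ℂ) * psiR ((xLine p.1 : ℂ) + p.2 * I) + amp ((xLine p.1 : ℂ) + p.2 * I))))
      (atTop ×ˢ 𝓝 u0) (𝓝 1) := by
    rw [Metric.tendsto_nhds]
    intro ε hε
    have hu : ∀ᶠ u : ℝ in 𝓝 u0, 1 / 10 ≤ u := Ici_mem_nhds (by linarith)
    filter_upwards [(eventually_norm_E_sub_one_lt hε).prod_mk hu] with p ⟨h1, h2⟩
    rw [dist_eq_norm]
    exact h1 _ (by simpa using h2)
  -- (2) `e^{A(κ)} → e^{A(κ₀)}`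
  have hA : Tendsto (fun p : ℕ × ℝ ↦ cexp (amp ((xLine p.1 : ℂ) + p.2 * I))) (atTop ×ˢ 𝓝 u0)
      (𝓝 (cexp (amp saddle))) := by
    have hopen : IsOpen {κ : ℂ | 0 < κ.im} := isOpen_lt continuous_const Complex.continuous_im
    have hsad : saddle ∈ {κ : ℂ | 0 < κ.im} := by rw [← x0_add_u0_I]; simp; linarith
    have hcont : ContinuousAt amp saddle := continuousOn_amp.continuousAt (hopen.mem_nhds hsad)
    exact ((Complex.continuous_exp.tendsto _).comp hcont.tendsto).comp tendsto_linePoint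
  -- (3) `k(nu) → 4`
  have hk : Tendsto (fun p : ℕ × ℝ ↦ ((Real.sinh (π * (p.1 * p.2)) / Real.cosh (π * (p.1 * p.2)) ^ 3 *
      Real.exp (2 * (π * (p.1 * p.2))) : ℝ) : ℂ)) (atTop ×ˢ 𝓝 u0) (𝓝 ((4 : ℝ) : ℂ)) := by
    have hprod : Tendsto (fun p : ℕ × ℝ ↦ (p.1 : ℝ) * p.2) (atTop ×ˢ 𝓝 u0) atTop :=
      ((tendsto_natCast_atTop_atTop (R := ℝ)).comp tendsto_fst).atTop_mul_pos (by linarith) tendsto_snd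
    have hy : Tendsto (fun p : ℕ × ℝ ↦ π * ((p.1 : ℝ) * p.2)) (atTop ×ˢ 𝓝 u0) atTop :=
      hprod.const_mul_atTop Real.pi_pos
    exact (Complex.continuous_ofReal.tendsto 4).comp (tendsto_sinh_div_cosh_cube_mul_exp.comp hy)
  -- (4) `e^{n(Φ(κ) − Φ(x₀+iu))} → 1`
  have hph : Tendsto (fun p : ℕ × ℝ ↦ cexp ((p.1 : ℂ) * phase ((xLine p.1 : ℂ) + p.2 * I)) *
      cexp (-((p.1 : ℂ) * phase ((x0 : ℂ) + p.2 * I)))) (atTop ×ˢ 𝓝 u0) (𝓝 1) := by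
    have h := (Complex.continuous_exp.tendsto 0).comp tendsto_natCast_mul_phase_sub
    rw [Complex.exp_zero] at h
    refine h.congr fun p ↦ ?_
    simp only [Function.comp_apply, ← Complex.exp_add]
    congr 1; ring
  have := ((hE.neg.mul hA).mul hk).mul hph
  refine this.congr' (Eventually.of_forall fun p ↦ by ring) |>.trans ?_
  rw [show -1 * cexp (amp saddle) * ((4 : ℝ) : ℂ) * 1 = -4 * cexp (amp saddle) by push_cast; ring]

/-! ### The Laplace method on the line -/

/-- **`√n e^{−nΦ(κ₀)} ∫_{u>0} G_n(u) du → Λ ≠ 0`** (`Λ = −4 e^{A(κ₀)} (2π/Φ''(κ₀))^{1/2}`): the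
Laplace method with complex phase on the descent line `re κ = x₀`, the piece `0 < u ≤ 1/10` being
exponentially smaller. [cite: Zudilin2004, §8 Lemma 20] -/
theorem tendsto_lineIntegral : ∃ Λ : ℂ, Λ ≠ 0 ∧
    Tendsto (fun n : ℕ ↦ (Real.sqrt n : ℂ) * cexp (-((n : ℂ) * phase saddle)) * ∫ u in Set.Ioi (0 : ℝ), Gfun n u)
      atTop (𝓝 Λ) := by
  have hu0 := u0_bounds
  -- the data of the Laplace method
  set c : ℂ := ddphase saddle / 2 with hc_def
  have hc : 0 < c.re := by
    have := re_ddphase_saddle_ge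
    rw [hc_def, Complex.div_ofNat_re]; linarith
  have hcre : 3 / 10 ≤ c.re := by
    have := re_ddphase_saddle_ge
    rw [hc_def, Complex.div_ofNat_re]; linarith
  set C₂ : ℝ := 1 / 2 * ∑ v ∈ Finset.Icc (1 : ℕ) 10, Real.log (2 * Real.pi * (13 + 2 * (v : ℝ))) -
    3 * Real.log (54 * Real.pi) with hC₂
  set W₀ : ℝ → ℝ := fun u ↦ 8 * Real.exp (17 * (Real.log (180 + 2 * u) + π) + |C₂| +
    (32 * (Real.log (180 + 2 * u) + π) + 2 * π) / 2) with hW₀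
  obtain ⟨N₁, hN₁⟩ := eventually_atTop.1 eventually_norm_E_le_two
  set N : ℕ := max N₁ 1 with hN
  have hNE : ∀ n, N ≤ n → ∀ κ : ℂ, 1 / 10 ≤ κ.im →
      ‖R n ((n : ℂ) * κ) * (n : ℂ) ^ 7 * cexp (-((n : ℂ) * psiR κ + amp κ))‖ ≤ 2 :=
    fun n hn ↦ hN₁ n ((le_max_left _ _).trans hn)
  have hN1 : ∀ n, N ≤ n → 1 ≤ n := fun n hn ↦ (le_max_right _ _).trans hn
  set Q : ℕ → ℝ → ℂ := fun n u ↦ if N ≤ n then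
    Set.indicator (Set.Ioi (1 / 10)) (fun u ↦ Gfun n u * cexp (-((n : ℂ) * linePhase u))) u else 0 with hQ_def
  set W : ℝ → ℝ := Set.indicator (Set.Ioi (1 / 10)) W₀ with hW_def
  have hW₀pos : ∀ u, 0 ≤ W₀ u := fun u ↦ by positivity
  have hW₀mono : ∀ u v, -1 ≤ u → u ≤ v → W₀ u ≤ W₀ v := by
    intro u v hu huv
    have : Real.log (180 + 2 * u) ≤ Real.log (180 + 2 * v) := Real.log_le_log (by linarith) (by linarith)
    simp only [hW₀]
    gcongr
  -- Taylor
  have hT : ∀ u : ℝ, |u - u0| ≤ 1 / 20 → ‖linePhase u - linePhase u0 + c * (u - u0) ^ 2‖ ≤ 3 * |u - u0| ^ 3 := by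
    intro u hu
    have hu' : 1 / 10 ≤ u := by rw [abs_le] at hu; linarith
    rw [linePhase_eq hu', linePhase_u0, hc_def]
    exact taylor_phase_vline hu
  -- the gap
  have hgap : ∀ u : ℝ, 1 / 20 ≤ |u - u0| → (linePhase u).re ≤ (linePhase u0).re - 3 / 4000 := by
    intro u hu
    rw [linePhase_u0]
    rcases le_or_gt u (1 / 10) with hle | hgt
    · rw [linePhase_eq_of_le hle]
      have := SaddleNum.re_phase_tenth_add_four_le saddle_mem_boxB (κ' := (x0 : ℂ) + (1 / 10 : ℝ) * I)
        (by simpa using abs_x0_sub_le) (by simp)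
      linarith
    · rw [linePhase_eq hgt.le]
      have := re_phase_x0_gap (d := 1 / 20) (by norm_num) (by norm_num) (by linarith) hu
      linarith
  -- measurability
  have hQm : ∀ n, Measurable (Q n) := by
    intro n
    by_cases hn : N ≤ n
    · simp only [hQ_def, hn, if_true]
      refine Measurable.indicator ?_ measurableSet_Ioi
      exact ((continuous_Gfun (hN1 n hn)).mul (Complex.continuous_exp.comp
        (continuous_const.mul continuous_linePhase).neg)).measurable
    · simp only [hQ_def, hn, if_false]; exact measurable_const
  -- the majorant
  have hQW : ∀ n u, ‖Q n u‖ ≤ W u := by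
    intro n u
    by_cases hn : N ≤ n
    · by_cases hu : u ∈ Set.Ioi (1 / 10)
      · simp only [hQ_def, hn, if_true, hW_def, Set.indicator_of_mem hu]
        rw [linePhase_eq (le_of_lt hu)]
        exact norm_Gfun_mul_cexp_le (hN1 n hn) (hNE n hn) hu
      · simp only [hQ_def, hn, if_true, hW_def, Set.indicator_of_notMem hu, norm_zero]; exact le_rfl
    · simp only [hQ_def, hn, if_false, norm_zero, hW_def]
      exact Set.indicator_nonneg (fun u _ ↦ hW₀pos u) u
  have hWB : ∀ u : ℝ, |u - u0| ≤ 1 / 20 → W u ≤ W₀ (7 / 2) := by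
    intro u hu
    rw [abs_le] at hu
    simp only [hW_def]
    by_cases hu' : u ∈ Set.Ioi (1 / 10)
    · rw [Set.indicator_of_mem hu']; exact hW₀mono u _ (by linarith) (by linarith)
    · rw [Set.indicator_of_notMem hu']; exact hW₀pos _
  have hWint : Integrable (fun u ↦ W u * Real.exp ((linePhase u).re - (linePhase u0).re)) := by
    have e : (fun u ↦ W u * Real.exp ((linePhase u).re - (linePhase u0).re)) =
        Set.indicator (Set.Ioi (1 / 10)) (fun u ↦ W₀ u * Real.exp ((phase ((x0 : ℂ) + u * I)).re - (phase saddle).re)) := by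
      funext u
      by_cases hu : u ∈ Set.Ioi (1 / 10)
      · simp only [hW_def, Set.indicator_of_mem hu, linePhase_eq (le_of_lt hu), linePhase_u0]
      · simp only [hW_def, Set.indicator_of_notMem hu, zero_mul]
    rw [e, integrable_indicator_iff measurableSet_Ioi]
    exact integrableOn_majorant |C₂| (phase saddle).re
  -- the limit of `Q`
  have hL : Tendsto (fun p : ℕ × ℝ ↦ Q p.1 p.2) (atTop ×ˢ 𝓝 u0) (𝓝 (-4 * cexp (amp saddle))) := by
    refine tendsto_amplitude.congr' ?_
    have hu : ∀ᶠ u : ℝ in 𝓝 u0, 1 / 10 < u := Ioi_mem_nhds (by linarith)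
    filter_upwards [(eventually_ge_atTop N).prod_mk hu] with p ⟨hn, hu⟩
    simp only [hQ_def, hn, if_true, Set.indicator_of_mem (Set.mem_Ioi.2 hu), linePhase_eq hu.le]
    rw [Gfun_eq (hN1 _ hn)]
    ring
  -- the Laplace method
  have hB1 := tendsto_sqrt_mul_integral_exp_phase_sub_of_measurable continuous_linePhase hc
    (δ := 1 / 20) (M := 3) (η := 3 / 4000) (by norm_num) (by norm_num) (by linarith) (by norm_num)
    hT hgap hQm hQW hWB hWint hL
  -- the limit is nonzero
  set Λ : ℂ := -4 * cexp (amp saddle) * (π / c) ^ (1 / 2 : ℂ) with hΛ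
  have hΛ0 : Λ ≠ 0 := by
    have hc0 : c ≠ 0 := fun h ↦ by rw [h, Complex.zero_re] at hc; exact lt_irrefl _ hc
    refine mul_ne_zero (mul_ne_zero (by norm_num) (Complex.exp_ne_zero _)) ?_
    rw [Ne, Complex.cpow_eq_zero_iff, not_and_or]
    exact Or.inl (div_ne_zero (by exact_mod_cast Real.pi_pos.ne') hc0)
  refine ⟨Λ, hΛ0, ?_⟩
  -- the region `0 < u ≤ 1/10`
  set CG : ℝ := 8 * Real.exp (17 * (Real.log (180 + 2 * (1 / 10)) + π) + |C₂| +
    (32 * (Real.log (180 + 2 * (1 / 10)) + π) + 2 * π) / 2) with hCG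
  have hsmall : Tendsto (fun n : ℕ ↦ (Real.sqrt n : ℂ) * cexp (-((n : ℂ) * phase saddle)) *
      ∫ u in Set.Ioc (0 : ℝ) (1 / 10), Gfun n u) atTop (𝓝 0) := by
    rw [tendsto_zero_iff_norm_tendsto_zero]
    have hbound : ∀ᶠ n : ℕ in atTop, ‖(Real.sqrt n : ℂ) * cexp (-((n : ℂ) * phase saddle)) *
        ∫ u in Set.Ioc (0 : ℝ) (1 / 10), Gfun n u‖ ≤ CG / 10 * (Real.sqrt n * Real.exp (-((n : ℝ) - 1) * 3)) * Real.exp (-3) := by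
      filter_upwards [eventually_ge_atTop N] with n hn
      have hint : ‖∫ u in Set.Ioc (0 : ℝ) (1 / 10), Gfun n u‖ ≤ CG * Real.exp (n * ((phase saddle).re - 3)) * (1 / 10) := by
        have := norm_setIntegral_le_of_norm_le_const (s := Set.Ioc (0 : ℝ) (1 / 10)) (f := Gfun n)
          (C := CG * Real.exp (n * ((phase saddle).re - 3))) (by rw [Real.volume_Ioc]; exact ENNReal.ofReal_lt_top)
          (fun u hu ↦ norm_Gfun_le_of_le_tenth (hN1 n hn) (hNE n hn) hu.1 hu.2)
        rwa [Real.volume_real_Ioc_of_le (by norm_num), sub_zero] at this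
      rw [norm_mul, norm_mul, Complex.norm_real, Real.norm_eq_abs, abs_of_nonneg (Real.sqrt_nonneg _),
        Complex.norm_exp]
      have ere : (-((n : ℂ) * phase saddle)).re = -(n * (phase saddle).re) := by simp
      rw [ere]
      calc Real.sqrt n * Real.exp (-(n * (phase saddle).re)) * ‖∫ u in Set.Ioc (0 : ℝ) (1 / 10), Gfun n u‖
          ≤ Real.sqrt n * Real.exp (-(n * (phase saddle).re)) * (CG * Real.exp (n * ((phase saddle).re - 3)) * (1 / 10)) :=
            mul_le_mul_of_nonneg_left hint (by positivity)
        _ = CG / 10 * (Real.sqrt n * Real.exp (-((n : ℝ) - 1) * 3)) * Real.exp (-3) := by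
            rw [show -((n : ℝ) - 1) * 3 = -(n * (phase saddle).re) + n * ((phase saddle).re - 3) + 3 by ring,
              Real.exp_add, Real.exp_add]
            have : Real.exp 3 * Real.exp (-3) = 1 := by rw [← Real.exp_add]; simp
            linear_combination (-(CG / 10 * Real.sqrt n * Real.exp (-(n * (phase saddle).re)) *
              Real.exp (n * ((phase saddle).re - 3)))) * this
    have hlim : Tendsto (fun n : ℕ ↦ CG / 10 * (Real.sqrt n * Real.exp (-((n : ℝ) - 1) * 3)) * Real.exp (-3))
        atTop (𝓝 0) := by
      have := ((tendsto_sqrt_mul_exp_neg 3 (by norm_num)).const_mul (CG / 10)).mul_const (Real.exp (-3))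
      simpa using this
    exact squeeze_zero_norm' (hbound.mono fun n hn ↦ by rwa [Real.norm_eq_abs, abs_norm]) hlim
  -- the identity between the two integrals, for `n ≥ N`
  have hident : ∀ᶠ n : ℕ in atTop, (Real.sqrt n : ℂ) * cexp (-((n : ℂ) * phase saddle)) * ∫ u in Set.Ioi (0 : ℝ), Gfun n u =
      (Real.sqrt n : ℂ) * cexp (-((n : ℂ) * phase saddle)) * (∫ u in Set.Ioc (0 : ℝ) (1 / 10), Gfun n u) +
      (Real.sqrt n : ℂ) * ∫ u, cexp (n * (linePhase u - linePhase u0)) * Q n u := by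
    filter_upwards [eventually_ge_atTop N] with n hn
    have hn1 := hN1 n hn
    have hsplit : ∫ u in Set.Ioi (0 : ℝ), Gfun n u = (∫ u in Set.Ioc (0 : ℝ) (1 / 10), Gfun n u) + ∫ u in Set.Ioi (1 / 10 : ℝ), Gfun n u := by
      rw [← setIntegral_union (Set.Ioc_disjoint_Ioi le_rfl) measurableSet_Ioi
        (integrable_Gfun hn1).integrableOn (integrable_Gfun hn1).integrableOn,
        Set.Ioc_union_Ioi_eq_Ioi (by norm_num)]
    have hQint : ∫ u, cexp (n * (linePhase u - linePhase u0)) * Q n u =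
        cexp (-((n : ℂ) * phase saddle)) * ∫ u in Set.Ioi (1 / 10 : ℝ), Gfun n u := by
      have e : (fun u ↦ cexp (n * (linePhase u - linePhase u0)) * Q n u) =
          Set.indicator (Set.Ioi (1 / 10)) (fun u ↦ cexp (-((n : ℂ) * phase saddle)) * Gfun n u) := by
        funext u
        by_cases hu : u ∈ Set.Ioi (1 / 10)
        · simp only [hQ_def, hn, if_true, Set.indicator_of_mem hu, linePhase_u0]
          rw [show cexp (n * (linePhase u - phase saddle)) * (Gfun n u * cexp (-((n : ℂ) * linePhase u))) =
            (cexp (n * (linePhase u - phase saddle)) * cexp (-((n : ℂ) * linePhase u))) * Gfun n u by ring,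
            ← Complex.exp_add]
          congr 2; ring
        · simp only [hQ_def, hn, if_true, Set.indicator_of_notMem hu, mul_zero]
      rw [e, integral_indicator measurableSet_Ioi, integral_const_mul]
    rw [hsplit, hQint]
    ring
  -- conclusion
  have hmain := hsmall.add hB1
  rw [zero_add] at hmain
  exact hmain.congr' (hident.mono fun n hn ↦ hn.symm)

/-! ### Consequences for `Sₙ` -/

/-- **The asymptotic shape of Zudilin's linear forms**: there are `Λ ≠ 0` and `Aₙ → Λ` with
`Sₙ = −π² n^{−13/2} e^{n Re Φ(κ₀)} Im(e^{i n Im Φ(κ₀)} Aₙ)` for all large `n`.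
[cite: Zudilin2004, §8 Lemma 20] -/
theorem S_eventually_eq : ∃ Λ : ℂ, Λ ≠ 0 ∧ ∃ A : ℕ → ℂ, Tendsto A atTop (𝓝 Λ) ∧
    ∀ᶠ n : ℕ in atTop, S n = -π ^ 2 * ((n : ℝ) ^ 6 * Real.sqrt n)⁻¹ * Real.exp (n * (phase saddle).re) *
      (cexp (((n : ℝ) * (phase saddle).im : ℝ) * I) * A n).im := by
  obtain ⟨Λ, hΛ, hA⟩ := tendsto_lineIntegral
  refine ⟨Λ, hΛ, _, hA, ?_⟩
  filter_upwards [eventually_ge_atTop 1] with n hn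
  have hn' : (0 : ℝ) < n := by exact_mod_cast hn
  have hsq : (0 : ℝ) < Real.sqrt n := Real.sqrt_pos.2 hn'
  rw [S_eq_Gfun hn]
  -- `n⁻⁶ ∫ G = (n⁶ √n)⁻¹ e^{nΦ(κ₀)} · (√n e^{−nΦ(κ₀)} ∫ G)`
  set J := ∫ u in Set.Ioi (0 : ℝ), Gfun n u with hJ
  have e1 : ((n : ℂ)⁻¹) ^ 6 * J = ((((n : ℝ) ^ 6 * Real.sqrt n)⁻¹ : ℝ) : ℂ) *
      (cexp ((n : ℂ) * phase saddle) * ((Real.sqrt n : ℂ) * cexp (-((n : ℂ) * phase saddle)) * J)) := by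
    have hs0 : (Real.sqrt n : ℂ) ≠ 0 := by exact_mod_cast hsq.ne'
    have hn0 : (n : ℂ) ≠ 0 := by exact_mod_cast hn'.ne'
    rw [show cexp ((n : ℂ) * phase saddle) * ((Real.sqrt n : ℂ) * cexp (-((n : ℂ) * phase saddle)) * J) =
      (cexp ((n : ℂ) * phase saddle) * cexp (-((n : ℂ) * phase saddle))) * (Real.sqrt n : ℂ) * J by ring,
      ← Complex.exp_add, add_neg_cancel, Complex.exp_zero, one_mul]
    push_cast
    field_simp
  have e2 : cexp ((n : ℂ) * phase saddle) = ((Real.exp (n * (phase saddle).re) : ℝ) : ℂ) *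
      cexp (((n : ℝ) * (phase saddle).im : ℝ) * I) := by
    rw [Complex.ofReal_exp, ← Complex.exp_add]
    congr 1
    apply Complex.ext <;> simp
  rw [e1, e2]
  set A := (Real.sqrt n : ℂ) * cexp (-((n : ℂ) * phase saddle)) * J
  rw [show ((((n : ℝ) ^ 6 * Real.sqrt n)⁻¹ : ℝ) : ℂ) * (((Real.exp (n * (phase saddle).re) : ℝ) : ℂ) *
      cexp (((n : ℝ) * (phase saddle).im : ℝ) * I) * A) =
      (((((n : ℝ) ^ 6 * Real.sqrt n)⁻¹ * Real.exp (n * (phase saddle).re) : ℝ) : ℂ)) *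
      (cexp (((n : ℝ) * (phase saddle).im : ℝ) * I) * A) by push_cast; ring,
    Complex.im_ofReal_mul]
  ring

/-- **Decay of Zudilin's linear forms**: `|Sₙ| ≤ e^{−c₁ n}` for all large `n`, for every
`c₁ < 227.58` (`C₀ = 227.58019641…`). [cite: Zudilin2004, §8 Lemma 20, Prop. 5] -/
theorem S_decay {c₁ : ℝ} (hc : c₁ < 22758 / 100) : ∀ᶠ n : ℕ in atTop, |S n| ≤ Real.exp (-c₁ * n) := by
  obtain ⟨Λ, -, A, hA, heq⟩ := S_eventually_eq
  have hP0 := re_phase_saddle_le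
  -- `‖A n‖ ≤ ‖Λ‖ + 1` eventually
  have hAn : ∀ᶠ n : ℕ in atTop, ‖A n‖ ≤ ‖Λ‖ + 1 := by
    have := (hA.norm).eventually (Iic_mem_nhds (show ‖Λ‖ < ‖Λ‖ + 1 by linarith))
    exact this
  -- `π² (‖Λ‖ + 1) ≤ e^{κ n}` eventually, `κ = −(Re Φ(κ₀) + c₁) > 0`
  have hκ : 0 < -((phase saddle).re + c₁) := by linarith
  have hgrow : ∀ᶠ n : ℕ in atTop, π ^ 2 * (‖Λ‖ + 1) ≤ Real.exp (-((phase saddle).re + c₁) * n) := by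
    have h := Real.tendsto_exp_atTop.comp
      ((tendsto_natCast_atTop_atTop (R := ℝ)).const_mul_atTop hκ)
    exact h.eventually (eventually_ge_atTop _)
  filter_upwards [heq, hAn, hgrow, eventually_ge_atTop 1] with n hS hA' hg hn
  have hn' : (1 : ℝ) ≤ n := by exact_mod_cast hn
  rw [hS]
  have h1 : |(cexp (((n : ℝ) * (phase saddle).im : ℝ) * I) * A n).im| ≤ ‖Λ‖ + 1 := by
    refine (abs_im_le_norm _).trans ?_
    rw [norm_mul, Complex.norm_exp_ofReal_mul_I, one_mul]
    exact hA'
  have h2 : ((n : ℝ) ^ 6 * Real.sqrt n)⁻¹ ≤ 1 := by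
    refine inv_le_one_of_one_le₀ ?_
    have : 1 ≤ Real.sqrt n := by rw [Real.one_le_sqrt]; exact hn'
    nlinarith [one_le_pow₀ (n := 6) hn']
  have h3 : 0 ≤ ((n : ℝ) ^ 6 * Real.sqrt n)⁻¹ := by positivity
  rw [abs_mul, abs_mul, abs_mul, abs_of_pos (Real.exp_pos _), abs_of_nonneg h3,
    show |-π ^ 2| = π ^ 2 by rw [abs_neg, abs_of_pos (by positivity)]]
  calc π ^ 2 * ((n : ℝ) ^ 6 * Real.sqrt n)⁻¹ * Real.exp (n * (phase saddle).re) *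
        |(cexp (((n : ℝ) * (phase saddle).im : ℝ) * I) * A n).im|
      ≤ π ^ 2 * 1 * Real.exp (n * (phase saddle).re) * (‖Λ‖ + 1) := by gcongr
    _ = π ^ 2 * (‖Λ‖ + 1) * Real.exp (n * (phase saddle).re) := by ring
    _ ≤ Real.exp (-((phase saddle).re + c₁) * n) * Real.exp (n * (phase saddle).re) :=
        mul_le_mul_of_nonneg_right hg (Real.exp_pos _).le
    _ = Real.exp (-c₁ * n) := by rw [← Real.exp_add]; congr 1; ring

/-- **Non-vanishing of Zudilin's linear forms**: `Sₙ ≠ 0` for infinitely many `n`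
(`Im Φ(κ₀) ∈ 58π + (1/5, 1/2)`, so the two conjugate saddle points do not cancel for long).
[cite: Zudilin2004, §8 Lemma 20] -/
theorem S_frequently_ne_zero : ∃ᶠ n : ℕ in atTop, S n ≠ 0 := by
  obtain ⟨Λ, hΛ, A, hA, heq⟩ := S_eventually_eq
  have hω : Real.sin (phase saddle).im ≠ 0 := sin_im_phase_saddle_pos.ne'
  have hL : -I * Λ ≠ 0 := mul_ne_zero (neg_ne_zero.2 Complex.I_ne_zero) hΛ
  have hε : Tendsto (fun n : ℕ ↦ -I * (A n - Λ)) atTop (𝓝 0) := by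
    have := (hA.sub_const Λ).const_mul (-I)
    rwa [sub_self, mul_zero] at this
  have hfreq := frequently_re_cexp_mul_ne_zero hL hω hε
  refine (hfreq.and_eventually (heq.and (eventually_ge_atTop 1))).mono ?_
  rintro n ⟨hre, hS, hn⟩
  have hn' : (0 : ℝ) < n := by exact_mod_cast hn
  rw [hS]
  have e : (cexp (((n : ℝ) * (phase saddle).im : ℝ) * I) * A n).im =
      (cexp (((n : ℝ) * (phase saddle).im : ℝ) * I) * (-I * Λ + -I * (A n - Λ))).re := by
    rw [show -I * Λ + -I * (A n - Λ) = -I * A n by ring,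
      show cexp (((n : ℝ) * (phase saddle).im : ℝ) * I) * (-I * A n) =
        -I * (cexp (((n : ℝ) * (phase saddle).im : ℝ) * I) * A n) by ring]
    simp
  rw [e]
  refine mul_ne_zero (mul_ne_zero (mul_ne_zero ?_ ?_) (Real.exp_pos _).ne') hre
  · exact neg_ne_zero.2 (by positivity)
  · exact inv_ne_zero (by positivity)

/-- **The analytic half of [Zudilin2004, Theorem 3], packaged for the glue**
`zudilin_of_linearForms_of_lt` of `ZudilinOddZeta.lean`: given the arithmetic of the linear forms
(Lemma 19) and `Φₙ ≥ e^{c₂ n}` eventually for some `c₂ > 403 − 227.58 = 175.42`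
(Zudilin: `403 − C₂ = 176.75…`), one of `ζ(5), ζ(7), ζ(9), ζ(11)` is irrational.
[cite: Zudilin2004, §8 Lemma 20, Prop. 5, Thm. 3] -/
theorem zudilin_of_arith {c₂ : ℝ} (hc₂ : 17542 / 100 < c₂)
    (harith : ∀ n : ℕ, 1 ≤ n → ∃ a : Fin 5 → ℤ,
      2 * (D n : ℝ) * S n = Phi n * (a 0 + a 1 * zetaValue 5 + a 2 * zetaValue 7 +
        a 3 * zetaValue 9 + a 4 * zetaValue 11))
    (hPhi : ∀ᶠ n : ℕ in atTop, Real.exp (c₂ * n) ≤ Phi n) : zudilin :=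
  zudilin_of_linearForms_of_lt (c₁ := (403 - c₂ + 22758 / 100) / 2) (by linarith) harith
    (S_decay (by linarith)) S_frequently_ne_zero hPhi

end Zudilin2004

end Literature.NumberTheory.Transcendental
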